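import Mathlib
import Summits.Ventures.HodgeRepro2.T6NAut
import Summits.Ventures.HodgeRepro2.T6N42Main

/-!
# T6N42Contract — sub-step N4.2 in the M2 composition shape (TARGET-T6 v0.4 §9.3; owner t6-p5)

The lead's composition carrier `NAut F P` (T6NAut) bundles t6-p5's datum as the field
`NSide.d42 : N42Datum.FinitePlacesDatum` of each of the two N4 sides `M.sA` (`π₀` on `W_A = W₁₂`)
and `M.sB` (`π₀′` on `W_B = W₃₄`), and identifies N4.2's conclusion with N4.1's finite-place half
of (H_loc) through the compat field `NSide.theta_fin` (`NSide.hloc_fin_iff`). This file states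
`N42_main` (T6N42Main, p401271) over that carrier, exactly as §9.3 reads it: «`N42_main … :
∀ v non-split finite, Θ_{V_v}(π₀,v) ≠ 0`», consumed by `N4_main` (t6-p4) BY NAME as the finite
half of (H_loc) — (a) per side (`N42_side`), (b) in N4.1's words (`N42_side_hloc_fin`:
`∀ v, s.d41.thetaNonzero (Sum.inl v)`), (c) in the zeta-integral form of row B0
(`N42_side_zeta`, through the class-AC display), and (d) over `(P : NDatum F) (M : NAut F P)` for
both sides at once (`N42_main_M`). No new display, no new datum, no new mathematics: every
theorem here is `N42Main.N42_main` / `N42Main.N42_zeta_main` applied to a field of `M`, plus the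
lead's `hloc_fin_iff`. The binders are the ones of `N42_main`, with their residual classes as in
route/T6-N42-t6-p5.md §13: `hM` / `hGI` = the two PRINT displays (class 0); `hGQTs` / `hGQTn` =
the AC display; `hIS` / `hFL` = interface Props (class IR unless Layer III constructs them);
`hpos` / `hnm` = discharged by `sizes_of_splitSizes23` once the datum fixes `(n, m) = (2, 3)`
(`SplitSizes23`, class 0 by `rfl` on a constructed datum).

README §8(d): uses an L-value-free non-vanishing device: NO (TIER5 §N4.2, a pre-02:16Z line of
record, continued).
-/

namespace Summit.Ventures.HodgeRepro2.T6.N42Contract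

open Summit.Ventures.HodgeRepro2.T6
open Summit.Ventures.HodgeRepro2.T6.N42Defs
open Summit.Ventures.HodgeRepro2.T6.N42Datum

variable {K : Type*} [Field K] [NumberField K]

/-- The sizes of the type II dual pair at every split place are `(n, m) = (2, 3)` — the datum of
N4.2 (`(GL₂(F_v), GL₃(F_v))`, `dim W₁₂ = 2`, `dim V = 3`). A `Prop` on the datum, discharged by
`rfl` on a datum constructed with these sizes. -/
def SplitSizes23 (D : FinitePlacesDatum) : Prop :=
  ∀ v, (D.splitDatum v).n = 2 ∧ (D.splitDatum v).m = 3

/-- `(n, m) = (2, 3)` discharges the two size binders of `N42_main`: `0 < n` and `n ≤ m`. -/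
theorem sizes_of_splitSizes23 (D : FinitePlacesDatum) (h : SplitSizes23 D) :
    (∀ v, 0 < (D.splitDatum v).n) ∧ D.TypeIISizes :=
  ⟨fun v => by rw [(h v).1]; exact Nat.zero_lt_succ 1,
    fun v => by rw [(h v).1, (h v).2]; exact Nat.le_succ 2⟩

/-- N4.2 for ONE side `s` of N4 (`M.sA` or `M.sB`): the local theta lift of `π₀,v` to `U(V_v)` is
non-zero at every finite place of `F⁺` — `Hom_{GL₂}(ω_{2,3}, π₀,v) ≠ 0` at the split places
(Mínguez 2008 Thm 1(2)) and `Θ_{V₁}(π₀,v) ≠ 0` at the non-split places (Gan–Ichino 2014 Prop. 5.3(i)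
with the first lift `π₀,v = θ_{W₁₂,v}(β′_v)`). This is `N42Main.N42_main` on `s.d42`. -/
theorem N42_side (s : NSide) (hIS : s.d42.IrreducibleSmooth)
    (hpos : ∀ v, 0 < (s.d42.splitDatum v).n) (hnm : s.d42.TypeIISizes) (hFL : s.d42.FirstLift)
    (hM : ∀ v, Hyp.Minguez2008_Theoreme1_2 (s.d42.splitDatum v))
    (hGI : ∀ v, Hyp.GanIchino2014_Prop5_3_i (s.d42.towerDatum v)) :
    s.d42.ThetaNonzeroEverywhere :=
  N42Main.N42_main s.d42 hIS hpos hnm hFL hM hGI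

/-- `N42_side` in N4.1's words: the finite-place half of (H_loc) of the side's doubling-L datum
`s.d41`, `∀ v finite, thetaNonzero v`, through the lead's compat field `theta_fin`
(`NSide.hloc_fin_iff`). This is the statement `N4_main` consumes as the finite conjunct of
`N42_main ∧ N43_main` (TARGET-T6 v0.4 §9.4 (q3)). -/
theorem N42_side_hloc_fin (s : NSide) (hIS : s.d42.IrreducibleSmooth)
    (hpos : ∀ v, 0 < (s.d42.splitDatum v).n) (hnm : s.d42.TypeIISizes) (hFL : s.d42.FirstLift)
    (hM : ∀ v, Hyp.Minguez2008_Theoreme1_2 (s.d42.splitDatum v))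
    (hGI : ∀ v, Hyp.GanIchino2014_Prop5_3_i (s.d42.towerDatum v)) :
    ∀ v : s.d42.Place, s.d41.thetaNonzero (Sum.inl v) :=
  s.hloc_fin_iff.mpr (N42_side s hIS hpos hnm hFL hM hGI)

/-- The zeta-integral form of (R2) for one side (TIER5 §B row B0): `Z_v^*(½) ≢ 0` on
`R(V_v) ⊗ π₀,v^∨ ⊗ π₀,v` at every finite place, through the class-AC display GQT Prop. 35(i)
(`N42Main.N42_zeta_main` on `s.d42`). -/
theorem N42_side_zeta (s : NSide) (hIS : s.d42.IrreducibleSmooth)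
    (hpos : ∀ v, 0 < (s.d42.splitDatum v).n) (hnm : s.d42.TypeIISizes) (hFL : s.d42.FirstLift)
    (hM : ∀ v, Hyp.Minguez2008_Theoreme1_2 (s.d42.splitDatum v))
    (hGI : ∀ v, Hyp.GanIchino2014_Prop5_3_i (s.d42.towerDatum v))
    (hGQTs : ∀ v, Hyp.GQT2014_Prop35_i (s.d42.splitDatum v).pair (s.d42.zetaSplit v))
    (hGQTn : ∀ v, Hyp.GQT2014_Prop35_i ((s.d42.towerDatum v).pair 1) (s.d42.zetaNonsplit v)) :
    s.d42.ZetaNonzeroEverywhere :=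
  N42Main.N42_zeta_main s.d42 hIS hpos hnm hFL hM hGI hGQTs hGQTn

/-- `N42_main` over the M2 carrier `(P : NDatum F) (M : NAut F P)` (TARGET-T6 v0.4 §9.3): N4.2 on
both sides of N4 — the side-A binders first (`π₀` on `W_A`), then the side-B binders (`π₀′` on
`W_B`); each side is `N42_side`. The displays are consumed by name, once per side. -/
theorem N42_main_M {F : FaceSetting K} (P : NDatum F) (M : NAut F P)
    (hIS_A : M.sA.d42.IrreducibleSmooth) (hpos_A : ∀ v, 0 < (M.sA.d42.splitDatum v).n)
    (hnm_A : M.sA.d42.TypeIISizes) (hFL_A : M.sA.d42.FirstLift)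
    (hM_A : ∀ v, Hyp.Minguez2008_Theoreme1_2 (M.sA.d42.splitDatum v))
    (hGI_A : ∀ v, Hyp.GanIchino2014_Prop5_3_i (M.sA.d42.towerDatum v))
    (hIS_B : M.sB.d42.IrreducibleSmooth) (hpos_B : ∀ v, 0 < (M.sB.d42.splitDatum v).n)
    (hnm_B : M.sB.d42.TypeIISizes) (hFL_B : M.sB.d42.FirstLift)
    (hM_B : ∀ v, Hyp.Minguez2008_Theoreme1_2 (M.sB.d42.splitDatum v))
    (hGI_B : ∀ v, Hyp.GanIchino2014_Prop5_3_i (M.sB.d42.towerDatum v)) :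
    M.sA.d42.ThetaNonzeroEverywhere ∧ M.sB.d42.ThetaNonzeroEverywhere :=
  ⟨N42_side M.sA hIS_A hpos_A hnm_A hFL_A hM_A hGI_A,
    N42_side M.sB hIS_B hpos_B hnm_B hFL_B hM_B hGI_B⟩

/-- `N42_main_M` in N4.1's words on both sides: the finite-place halves of (H_loc) of `M.sA.d41`
and `M.sB.d41` (the shape `N4_main` consumes, §9.4 (q3)). -/
theorem N42_main_M_hloc_fin {F : FaceSetting K} (P : NDatum F) (M : NAut F P)
    (hIS_A : M.sA.d42.IrreducibleSmooth) (hpos_A : ∀ v, 0 < (M.sA.d42.splitDatum v).n)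
    (hnm_A : M.sA.d42.TypeIISizes) (hFL_A : M.sA.d42.FirstLift)
    (hM_A : ∀ v, Hyp.Minguez2008_Theoreme1_2 (M.sA.d42.splitDatum v))
    (hGI_A : ∀ v, Hyp.GanIchino2014_Prop5_3_i (M.sA.d42.towerDatum v))
    (hIS_B : M.sB.d42.IrreducibleSmooth) (hpos_B : ∀ v, 0 < (M.sB.d42.splitDatum v).n)
    (hnm_B : M.sB.d42.TypeIISizes) (hFL_B : M.sB.d42.FirstLift)
    (hM_B : ∀ v, Hyp.Minguez2008_Theoreme1_2 (M.sB.d42.splitDatum v))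
    (hGI_B : ∀ v, Hyp.GanIchino2014_Prop5_3_i (M.sB.d42.towerDatum v)) :
    (∀ v : M.sA.d42.Place, M.sA.d41.thetaNonzero (Sum.inl v)) ∧
      ∀ v : M.sB.d42.Place, M.sB.d41.thetaNonzero (Sum.inl v) :=
  ⟨N42_side_hloc_fin M.sA hIS_A hpos_A hnm_A hFL_A hM_A hGI_A,
    N42_side_hloc_fin M.sB hIS_B hpos_B hnm_B hFL_B hM_B hGI_B⟩

end Summit.Ventures.HodgeRepro2.T6.N42Contract
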